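import Summits.KontsevichZagierPeriods.KontsevichZagierPeriods.Theses.FurushoPentagon
import Literature.NumberTheory.Transcendental.KZRulesAssociator
import Literature.NumberTheory.Transcendental.KZLogCalculusProofs
import Literature.NumberTheory.Transcendental.KZSubcalculusInvariants

/-!
# `ReducedPeriodRing` (stmt-KontsevichZagierPeriods-3929) — shape of a certificate; divisibility of `P`

A refutation of the crux is an additive map `φ : KZ.FormalRep →+ A` killing the four move families
with `φ c ≠ 0` for some `c` with `c * c ∈ KZ.relations` (`not_reducedPeriodRing_iff_certificate`;
the universal one is `KZ.toFormalPeriod`). Closed doors: `φ` cannot factor through `eval`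
(`certificate_comp_eval_vanishes`); cannot be multiplicative with values in a REDUCED ring —
`eval`, `evalP`, every realisation character `χ` of the rules (`multiplicative_certificate_vanishes`);
cannot take values in a group of bounded exponent (finite, `𝔽ₚ`-linear, parity / counting
invariants), because `P = FormalRep ⧸ relations` is DIVISIBLE: `[σ, f] ∼ N • [σ, f/N]`
(`exists_sub_nsmul_mem_relations`, from the tree's `KZ.IntegralRep.constMul` bookkeeping), so such
`φ` vanish identically (`bounded_exponent_certificate_vanishes`). By-product: every `N ≥ 1` is a
UNIT of `P` (`isUnit_natCast_formalPeriodRing`), `P` is uniquely divisible of characteristic `0`.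
So a certificate is in effect `ℚ`-linear, non-multiplicative (or nilpotent-valued) and blind to the
value: a genuinely new additive invariant of semialgebraic integrals — none is known
(= `¬` Conjecture 1, `Negative/RingForms.lean`). cdisprove (refuter) file; companion of
`Negative/LoadBearing.lean`, `Negative/RingForms.lean`, `Negative/PositiveCone.lean`.
[Kontsevich–Zagier 2001, §1.2 rule (1), §4.1]
-/

noncomputable section

namespace Summit.KontsevichZagierPeriods.KontsevichZagierPeriods.ReducedPeriodRingNegative

open Literature.NumberTheory.Transcendental KZ
open Summit.KontsevichZagierPeriods.KontsevichZagierPeriods.Theses.FurushoPentagon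

section Certificates

open MeasureTheory Set

variable {n : ℕ}

/-- **Certificate shape.** [folklore] -/
theorem not_reducedPeriodRing_iff_certificate :
    ¬ ReducedPeriodRing ↔
      ∃ (A : Type) (_ : AddCommGroup A) (φ : FormalRep →+ A),
        (∀ c ∈ relations, φ c = 0) ∧ ∃ c : FormalRep, c * c ∈ relations ∧ φ c ≠ 0 := by
  constructor
  · intro h
    obtain ⟨c, hc⟩ := not_forall.mp h
    obtain ⟨hcc, hcn⟩ := Classical.not_imp.mp hc
    refine ⟨FormalPeriodRing, inferInstance, (toFormalPeriod : FormalRep →ₙ+* FormalPeriodRing),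
      fun d hd => toFormalPeriod_eq_zero_of_mem hd, c, hcc, ?_⟩
    change toFormalPeriod c ≠ 0
    rwa [Ne, toFormalPeriod_eq_zero_iff]
  · rintro ⟨A, _, φ, hφ, c, hc, hne⟩ h
    exact hne (hφ c (h c hc))

/-- Certificates factoring through the value vanish on every candidate. [folklore] -/
theorem certificate_comp_eval_vanishes {A : Type*} [AddCommGroup A] (g : ℝ →+ A) {c : FormalRep}
    (hc : c * c ∈ relations) : g.comp eval c = 0 := by
  have h0 : eval (c * c) = 0 := relations_le_ker_eval_holds hc
  rw [eval_mul'] at h0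
  rw [AddMonoidHom.comp_apply, mul_self_eq_zero.mp h0, map_zero]

/-- **Multiplicative certificates into reduced rings vanish on every candidate**: if
`φ : FormalRep →ₙ+* R` kills the relations and `R` is reduced then `φ c = 0` whenever
`c * c ∈ relations` (`φ c` is nilpotent). Covers `eval`, `evalP`, and every realisation character
`χ` of the rules with reduced target. [folklore] -/
theorem multiplicative_certificate_vanishes {R : Type*} [CommRing R] [IsReduced R]
    (φ : FormalRep →ₙ+* R) (hφ : ∀ c ∈ relations, φ c = 0) {c : FormalRep}
    (hc : c * c ∈ relations) : φ c = 0 := by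
  have hsq : φ c * φ c = 0 := by rw [← map_mul]; exact hφ _ hc
  exact IsReduced.eq_zero _ ⟨2, by rw [pow_two]; exact hsq⟩

/-! Scaling is the tree's `KZ.IntegralRep.constMul` (`KZRelationsLE.lean`), and
`[σ, k f] ∼ k • [σ, f]` for `k : ℕ` is `KZ.IntegralRep.of_constMul_nat_sub_nsmul_mem_relations`
(`KZSubcalculusInvariants.lean`, iterated integrand additivity). -/

/-- `[σ, f] ∼ N • [σ, f/N]` for `N ≥ 1`. [KZ 2001, §1.2 rule (1)] -/
theorem of_sub_nsmul_of_constMul_inv_mem_relations (r : IntegralRep n) {N : ℕ} (hN : 0 < N) :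
    of r - N • of (r.constMul ((N : ℝ)⁻¹) (isAlgebraic_nat N).inv) ∈ relations := by
  have hN' : (N : ℝ) ≠ 0 := by exact_mod_cast hN.ne'
  have h1 : of r - of ((r.constMul ((N : ℝ)⁻¹) (isAlgebraic_nat N).inv).constMul (N : ℝ)
      (isAlgebraic_nat N)) ∈ relations :=
    of_sub_of_mem_relations_of_eqOn rfl (fun x _ => by simp [hN'])
  have h2 := (r.constMul ((N : ℝ)⁻¹) (isAlgebraic_nat N).inv).of_constMul_nat_sub_nsmul_mem_relations N
  have := relations.add_mem h1 h2
  simpa using this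

/-- **`P = FormalRep ⧸ relations` is a divisible group**: every formal combination is `N` times
another one modulo relations, for every `N ≥ 1`. [folklore] -/
theorem exists_sub_nsmul_mem_relations (c : FormalRep) {N : ℕ} (hN : 0 < N) :
    ∃ c' : FormalRep, c - N • c' ∈ relations := by
  induction c using FreeAbelianGroup.induction_on with
  | zero => exact ⟨0, by simp [relations.zero_mem]⟩
  | of x =>
    obtain ⟨n, r⟩ := x
    exact ⟨of (r.constMul ((N : ℝ)⁻¹) (isAlgebraic_nat N).inv),
      of_sub_nsmul_of_constMul_inv_mem_relations r hN⟩
  | neg x ih =>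
    obtain ⟨c', h⟩ := ih
    refine ⟨-c', ?_⟩
    have heq : -FreeAbelianGroup.of x - N • (-c') = -(FreeAbelianGroup.of x - N • c') := by
      rw [smul_neg]; abel
    rw [heq]
    exact relations.neg_mem h
  | add x y hx hy =>
    obtain ⟨c₁, h₁⟩ := hx
    obtain ⟨c₂, h₂⟩ := hy
    refine ⟨c₁ + c₂, ?_⟩
    have heq : x + y - N • (c₁ + c₂) = (x - N • c₁) + (y - N • c₂) := by
      rw [smul_add]; abel
    rw [heq]
    exact relations.add_mem h₁ h₂

/-- Divisibility of the formal period ring. [folklore] -/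
theorem formalPeriodRing_divisible (x : FormalPeriodRing) {N : ℕ} (hN : 0 < N) :
    ∃ y : FormalPeriodRing, x = N • y := by
  obtain ⟨c, rfl⟩ := toFormalPeriod_surjective x
  obtain ⟨c', h⟩ := exists_sub_nsmul_mem_relations c hN
  refine ⟨toFormalPeriod c', ?_⟩
  rw [← map_nsmul, toFormalPeriod_eq_iff]
  exact h

/-- **Bounded-exponent certificates vanish identically** (finite groups, `𝔽ₚ`-vector spaces, any
`A` with `N • A = 0`): the image of the divisible group `P` is divisible. In particular no parity /
counting invariant of the (domain, integrand) data can refute the crux. [folklore] -/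
theorem bounded_exponent_certificate_vanishes {A : Type*} [AddCommGroup A] (φ : FormalRep →+ A)
    (hφ : ∀ c ∈ relations, φ c = 0) {N : ℕ} (hN : 0 < N) (hA : ∀ a : A, N • a = 0)
    (c : FormalRep) : φ c = 0 := by
  obtain ⟨c', h⟩ := exists_sub_nsmul_mem_relations c hN
  have h0 : φ (c - N • c') = 0 := hφ _ h
  rw [map_sub, map_nsmul, hA, sub_zero] at h0
  exact h0

/-! ### Every non-zero integer is a unit of `P`

Divisibility applied to `1 = ⟦[pt, 1]⟧` gives `1 = N • y = N · y`, so `N` is invertible in `P`.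
Hence `P` is torsion-free and uniquely divisible — the route's support item `IntegerDivision`
(stmt-KontsevichZagierPeriods-3934: `N • c ∈ relations → c ∈ relations`) is the three-line
corollary `toFormalPeriod (N • c) = N · ⟦c⟧ = 0 ⇒ ⟦c⟧ = 0` (candidate proof attached to that item;
not restated here) — and `P` is a `ℚ`-algebra in all but name (`Negative/RationalAlgebra.lean`). -/

/-- **Every positive integer is a unit of the formal period ring** (`1 ∼ N • [pt, 1/N]`). [folklore] -/
theorem isUnit_natCast_formalPeriodRing {N : ℕ} (hN : 0 < N) :
    IsUnit ((N : ℕ) : FormalPeriodRing) := by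
  obtain ⟨y, hy⟩ := formalPeriodRing_divisible (1 : FormalPeriodRing) hN
  rw [nsmul_eq_mul] at hy
  exact IsUnit.of_mul_eq_one y hy.symm

/-- `P` is uniquely divisible: multiplication by `N ≥ 1` is a bijection of `P`. [folklore] -/
theorem nsmul_bijective {N : ℕ} (hN : 0 < N) :
    Function.Bijective fun x : FormalPeriodRing => N • x := by
  have hu := isUnit_natCast_formalPeriodRing hN
  constructor
  · intro x y hxy
    have h : (N : FormalPeriodRing) * x = (N : FormalPeriodRing) * y := by
      simpa only [nsmul_eq_mul] using hxy
    exact hu.mul_left_cancel h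
  · intro x
    obtain ⟨y, hy⟩ := formalPeriodRing_divisible x hN
    exact ⟨y, hy.symm⟩

/-- `P` has characteristic zero (`evalP` maps to `ℝ`). [folklore] -/
theorem charZero_formalPeriodRing : CharZero FormalPeriodRing :=
  evalP.charZero

end Certificates

end Summit.KontsevichZagierPeriods.KontsevichZagierPeriods.ReducedPeriodRingNegative
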